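import Mathlib
import HarnessLib
import Literature.Analysis.FluidPDE.SuitableWeak
import Literature.Analysis.FluidPDE.SelfSimilar
import Literature.Analysis.FluidPDE.LocalTypeI
import Literature.Analysis.FluidPDE.NSBoundedMildOseen
import Literature.Analysis.FluidPDE.LocalTypeIReverseZoom
import Literature.Analysis.FluidPDE.LocalTypeICongr

/-!
# Blow-down of a decaying non-trivial ancient slab solution: the apex profile
# (stub `stub_apexOfDecaying` for line decaying-ancient-bridge of crux RellichScar.ApexLocalisation)

The last step of the line `decaying-ancient-bridge` of the crux
`RellichScar.ApexLocalisation` (stmt-NavierStokesRegularity-11719).  Given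

* the ENGINE (Albritton–Barker 2019, §3 on the whole backward slab: compactness of
  Type-I-bounded suitable weak solutions on `(-∞, 0) × ℝ³` with persistence of singularities,
  the tree theorem `Literature.Analysis.FluidPDE.slab_typeI_compactness`, taken here as the first
  hypothesis), and
* a NON-trivial suitable weak solution `N` of Navier–Stokes (`ν = 1`, `f = 0`) on the slab with a
  weak gradient, `𝐈 < ∞` and the shifted space–time decay `‖N(t, x)‖ ≤ C'/(1 + ‖x‖ + √(−t))`,

we BLOW `N` DOWN about the space–time origin: `v_k = c_k N(c_k² s, c_k y)`, `c_k = k + 1 → ∞`.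
The zoom maps the slab onto itself, keeps suitability, the weak gradient and `𝐈`
(`zoom_isSuitableWeakSolutionOn`, `zoom_hasWeakSpatialGradientOn`, `typeIBound_lowerHalf_nsZoom`),
and IMPROVES the decay to the exact apex bound `‖v_k(s, y)‖ ≤ C'/(‖y‖ + √(−s))` for every `k`
(`c C'/(1 + c‖y‖ + c√(−s)) ≤ C'/(‖y‖ + √(−s))`).  Non-triviality gives a ball `Q(0, ρ)` with
`‖N‖_{L^∞(Q(0, ρ))} ≠ 0`, whence `‖v_k‖_{L^∞(Q(0, R))} = c_k ‖N‖_{L^∞(Q(0, c_k R))} → ∞` for every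
`R > 0`.  The ENGINE extracts a limit `(u, p, H)` on the slab with `𝐈 ≤ 4 𝐈(N) < ∞`, singular at
the origin by the persistence clause; `L³(Q(0, R))` convergence gives a.e. convergence along a
subsequence on every `Q(0, n + 1)`, so the apex bound passes to `u` almost everywhere on the slab
`= ⋃ₙ Q(0, n + 1)`, and `exists_apex_profile_repr` picks the representative with the POINTWISE
bound `HasTypeIDecay C'`.

Model: `localTypeISingularityExists_of_nontrivialMildAncientTypeIExists`
(`LocalTypeIReverse.lean`, A–B Thm 1.1 reverse direction), with the compactness on the whole slab
supplied by the ENGINE.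

## References

* D. Albritton, T. Barker, *On local Type I singularities of the Navier–Stokes equations and
  Liouville theorems*, J. Math. Fluid Mech. 21 (2019) = arXiv:1811.00502, Thm 1.1, §3.
  [AlbrittonBarker2019]
* G. Koch, N. Nadirashvili, G. Seregin, V. Šverák, Acta Math. 203 (2009), (1.6). [KNSS2009]
-/

-- the summit and its single sub-problem share the name (CONVENTIONS §1), as in every Theorems file
set_option linter.dupNamespace false

namespace Summit.NavierStokesRegularity.NavierStokesRegularity.Theorems.RellichScarApexLocalisation

open MeasureTheory Set Function Metric Filter Topology TopologicalSpace
open scoped ENNReal NNReal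
open Literature.Analysis Literature.Analysis.FluidPDE

local notation "E³" => EuclideanSpace ℝ (Fin 3)

/-! ### Tools for the blow-down about the origin -/

/-- **Blow-up of the `L^∞` norms along the blow-down sequence about the origin**, for a ball of
arbitrary radius: if `‖u‖_{L^∞(Q(0, ρ))} ≠ 0`, `ρ > 0`, and `c_k → ∞`, `c_k > 0`, then
`‖c_k u(c_k² s, c_k y)‖_{L^∞(Q(0, R))} → ∞` for every `R > 0` (for `c_k R ≥ ρ`,
`‖v_k‖_{L^∞(Q(0,R))} = c_k ‖u‖_{L^∞(Q(0, c_k R))} ≥ c_k ‖u‖_{L^∞(Q(0, ρ))}`; Albritton–Barker 2019,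
§3: `‖v^{(k)}‖_{L^∞(Q(1/k))} = k N → ∞`). [cite: AlbrittonBarker2019, §3] -/
theorem tendsto_eLpNorm_top_nsZoom_origin_atTop {u : ℝ → E³ → E³} {c : ℕ → ℝ}
    (hc : ∀ k, 0 < c k) (hctop : Tendsto c atTop atTop) {ρ : ℝ} (hρ : 0 < ρ)
    (hN : eLpNorm (uncurry u) ∞ (volume.restrict (parabolicCylinder ρ (0 : ℝ × E³))) ≠ 0) {R : ℝ}
    (hR : 0 < R) :
    Tendsto (fun k => eLpNorm (uncurry ((c k) • stPull (c k ^ 2) (c k) 0 (0 : E³) u)) ∞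
      (volume.restrict (parabolicCylinder R (0 : ℝ × E³)))) atTop (𝓝 ∞) := by
  set N := eLpNorm (uncurry u) ∞ (volume.restrict (parabolicCylinder ρ (0 : ℝ × E³))) with hNdef
  -- the comparison sequence `c_k N → ∞`
  have hb : Tendsto (fun k => ENNReal.ofReal (c k) * N) atTop (𝓝 ∞) := by
    have h1 : Tendsto (fun k => ENNReal.ofReal (c k)) atTop (𝓝 ∞) :=
      ENNReal.tendsto_ofReal_atTop.comp hctop
    have h2 := ENNReal.Tendsto.mul_const h1 (Or.inl ENNReal.top_ne_zero) (b := N)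
    rwa [ENNReal.top_mul hN] at h2
  refine tendsto_nhds_top_mono hb ?_
  filter_upwards [hctop.eventually_ge_atTop (ρ * R⁻¹)] with k hk
  have hcR : ρ ≤ c k * R := by
    have := mul_le_mul_of_nonneg_right hk hR.le
    rwa [mul_assoc, inv_mul_cancel₀ hR.ne', mul_one] at this
  have h0 : stAffine (c k ^ 2) (c k) 0 (0 : E³) 0 = 0 := by
    simp [stAffine, Prod.ext_iff]
  rw [eLpNorm_top_nsZoom (hc k) 0 (0 : E³) R 0, h0]
  gcongr
  refine eLpNorm_mono_measure _ (Measure.restrict_mono ?_ le_rfl)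
  -- `Q(0, ρ) ⊆ Q(0, c_k R)`
  have h2 : ρ ^ 2 ≤ (c k * R) ^ 2 := pow_le_pow_left₀ hρ.le hcR 2
  exact prod_mono (Ioo_subset_Ioo (by linarith) le_rfl) (ball_subset_ball hcR)

/-- The backward slab `(-∞, 0) × ℝ³` is exhausted by the parabolic balls `Q(0, n + 1)` centred
at the space–time origin. [folklore] -/
theorem lowerHalf_subset_iUnion_parabolicCylinder :
    Iio (0 : ℝ) ×ˢ (univ : Set E³) ⊆ ⋃ n : ℕ, parabolicCylinder ((n : ℝ) + 1) (0 : ℝ × E³) := by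
  rintro ⟨t, x⟩ ⟨ht, -⟩
  have ht : t < 0 := ht
  obtain ⟨n, hn⟩ := exists_nat_ge (max (-t) ‖x‖)
  refine mem_iUnion.2 ⟨n, ?_⟩
  rw [mem_parabolicCylinder]
  simp only [Prod.fst_zero, Prod.snd_zero, dist_zero_right]
  have h1 : -t ≤ n := (le_max_left _ _).trans hn
  have h2 : ‖x‖ ≤ n := (le_max_right _ _).trans hn
  refine ⟨⟨?_, ht⟩, by linarith⟩
  nlinarith [n.cast_nonneg (α := ℝ)]

/-- **Non-triviality localises at the origin**: a measurable field on `ℝ³ × ℝ₋` which is not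
a.e. zero has a parabolic ball `Q(0, n + 1)` centred at the space–time origin on which its `L^∞`
norm does not vanish (the balls `Q(0, n + 1)` exhaust the slab). [folklore] -/
theorem exists_radius_eLpNorm_top_ne_zero {u : ℝ → E³ → E³}
    (hu : AEStronglyMeasurable (uncurry u) (volume.restrict (Iio (0 : ℝ) ×ˢ (univ : Set E³))))
    (hnt : ¬ (uncurry u =ᵐ[volume.restrict (Iio (0 : ℝ) ×ˢ (univ : Set E³))] 0)) :
    ∃ n : ℕ, eLpNorm (uncurry u) ∞
      (volume.restrict (parabolicCylinder ((n : ℝ) + 1) (0 : ℝ × E³))) ≠ 0 := by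
  by_contra h
  refine hnt ?_
  have h' : ∀ n : ℕ, eLpNorm (uncurry u) ∞
      (volume.restrict (parabolicCylinder ((n : ℝ) + 1) (0 : ℝ × E³))) = 0 :=
    fun n => by_contra fun hn => h ⟨n, hn⟩
  -- on each ball the field vanishes a.e.
  have hball : ∀ n : ℕ, ∀ᵐ w ∂(volume.restrict (parabolicCylinder ((n : ℝ) + 1) (0 : ℝ × E³))),
      uncurry u w = (0 : ℝ × E³ → E³) w := by
    intro n
    have hsub : parabolicCylinder ((n : ℝ) + 1) (0 : ℝ × E³) ⊆ Iio (0 : ℝ) ×ˢ (univ : Set E³) :=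
      parabolicCylinder_subset_lowerHalf le_rfl _
    have hmeas : AEStronglyMeasurable (uncurry u)
        (volume.restrict (parabolicCylinder ((n : ℝ) + 1) (0 : ℝ × E³))) :=
      hu.mono_measure (Measure.restrict_mono hsub le_rfl)
    exact (eLpNorm_eq_zero_iff hmeas ENNReal.top_ne_zero).1 (h' n)
  have hS : ∀ᵐ w ∂(volume.restrict (⋃ n : ℕ, parabolicCylinder ((n : ℝ) + 1) (0 : ℝ × E³))),
      uncurry u w = (0 : ℝ × E³ → E³) w :=
    (ae_restrict_iUnion_iff _ _).2 hball
  exact ae_restrict_of_ae_restrict_of_subset lowerHalf_subset_iUnion_parabolicCylinder hS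

/-- The Navier–Stokes zoom about the space–time origin maps the backward slab onto itself
(`Opens` form of `stAffine_preimage_lowerHalf`). [folklore] -/
theorem stPreimage_slab_origin {c : ℝ} (hc : 0 < c) :
    stPreimage (c ^ 2) c 0 (0 : E³) (slab E³ (Iio 0) isOpen_Iio) = slab E³ (Iio 0) isOpen_Iio :=
  TopologicalSpace.Opens.ext (by
    rw [coe_stPreimage, coe_slab]
    exact stAffine_preimage_lowerHalf hc)

/-- **The blow-down improves the shifted decay to the apex bound.**  If
`‖N(t, x)‖ ≤ C/(1 + ‖x‖ + √(−t))` for `t < 0` with `0 ≤ C`, then for every zoom factor `c > 0`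
the field `v(s, y) = c N(c² s, c y)` satisfies `‖v(s, y)‖ ≤ C/(‖y‖ + √(−s))` for `s < 0`
(`c C/(1 + c‖y‖ + c√(−s)) ≤ C/(‖y‖ + √(−s))`; KNSS 2009, (1.6) is scale invariant).
[cite: KNSS2009, (1.6)] -/
theorem norm_nsZoom_origin_le_apex {C : ℝ} (hC : 0 ≤ C) {N : ℝ → E³ → E³}
    (hdec : ∀ t : ℝ, t < 0 → ∀ x : E³, ‖N t x‖ ≤ C / (1 + ‖x‖ + Real.sqrt (-t)))
    {c : ℝ} (hc : 0 < c) {s : ℝ} (hs : s < 0) (y : E³) :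
    ‖(c • stPull (c ^ 2) c 0 (0 : E³) N) s y‖ ≤ C / (‖y‖ + Real.sqrt (-s)) := by
  have hc2 : 0 < c ^ 2 := by positivity
  have hcs : 0 + c ^ 2 * s < 0 := by nlinarith
  have key := hdec (0 + c ^ 2 * s) hcs ((0 : E³) + c • y)
  have hsq : Real.sqrt (-(0 + c ^ 2 * s)) = c * Real.sqrt (-s) := by
    rw [zero_add, show -(c ^ 2 * s) = c ^ 2 * -s by ring, Real.sqrt_mul (sq_nonneg c),
      Real.sqrt_sq hc.le]
  rw [hsq, zero_add, zero_add, norm_smul, Real.norm_of_nonneg hc.le] at key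
  rw [smul_stPull_apply, norm_smul, Real.norm_of_nonneg hc.le, zero_add, zero_add]
  have hden : 0 < ‖y‖ + Real.sqrt (-s) :=
    add_pos_of_nonneg_of_pos (norm_nonneg _) (Real.sqrt_pos.2 (by linarith))
  have hden' : 0 < 1 + c * ‖y‖ + c * Real.sqrt (-s) := by positivity
  calc c * ‖N (c ^ 2 * s) (c • y)‖
      ≤ c * (C / (1 + c * ‖y‖ + c * Real.sqrt (-s))) := by gcongr
    _ = (c * C) / (1 + c * ‖y‖ + c * Real.sqrt (-s)) := by rw [mul_div_assoc']
    _ ≤ C / (‖y‖ + Real.sqrt (-s)) := by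
      rw [div_le_div_iff₀ hden' hden]
      have e : c * C * (‖y‖ + Real.sqrt (-s)) = C * (c * ‖y‖ + c * Real.sqrt (-s)) := by ring
      rw [e]
      exact mul_le_mul_of_nonneg_left (by linarith) hC

/-! ### The stub -/

/-- **Blow-down of a decaying non-trivial ancient slab solution** (the `⇐` transfer
`DecayingAncientGivesApex` of the line decaying-ancient-bridge): given the slab compactness ENGINE
(Albritton–Barker 2019, §3) and a non-trivial suitable weak solution `N` on `(-∞, 0) × ℝ³` with a
weak gradient, `𝐈 < ∞` and the shifted decay `‖N(t, x)‖ ≤ C'/(1 + ‖x‖ + √(−t))`, the blow-down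
`v_k = c_k N(c_k² s, c_k y)`, `c_k → ∞`, subconverges to a suitable weak solution on the slab with a
weak gradient, `𝐈 < ∞`, the pointwise apex bound `C'/(‖x‖ + √(−t))` and a backward-singular
origin. [cite: AlbrittonBarker2019, Thm 1.1 and §3] -/
theorem stub_apexOfDecaying :
    (∀ (I : ℝ≥0∞) (v : ℕ → ℝ → E³ → E³) (q : ℕ → ℝ → E³ → ℝ) (G : ℕ → ℝ → E³ → E³ →L[ℝ] E³),
      I < ⊤ →
      (∀ k, IsSuitableWeakSolutionOn (slab E³ (Iio 0) isOpen_Iio) 1 0 (v k) (q k)) →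
      (∀ k, HasWeakSpatialGradientOn (slab E³ (Iio 0) isOpen_Iio) (v k) (G k)) →
      (∀ k, typeIBound (Iio (0 : ℝ) ×ˢ univ) (v k) (q k) (G k) ≤ I) →
      ∃ (u : ℝ → E³ → E³) (p : ℝ → E³ → ℝ) (H : ℝ → E³ → E³ →L[ℝ] E³) (σ : ℕ → ℕ),
        StrictMono σ ∧
        IsSuitableWeakSolutionOn (slab E³ (Iio 0) isOpen_Iio) 1 0 u p ∧
        HasWeakSpatialGradientOn (slab E³ (Iio 0) isOpen_Iio) u H ∧
        typeIBound (Iio (0 : ℝ) ×ˢ univ) u p H ≤ 4 * I ∧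
        (∀ R : ℝ, 0 < R → Tendsto (fun j => eLpNorm (uncurry (v (σ j)) - uncurry u) 3
          (volume.restrict (parabolicCylinder R (0 : ℝ × E³)))) atTop (𝓝 0)) ∧
        ((∀ R : ℝ, 0 < R → limsup (fun j => eLpNorm (uncurry (v (σ j))) ⊤
            (volume.restrict (parabolicCylinder R (0 : ℝ × E³)))) atTop = ⊤) →
          IsBackwardSingularPoint u 0)) →
    (∃ (C' : ℝ) (N : ℝ → E³ → E³) (q : ℝ → E³ → ℝ) (H : ℝ → E³ → E³ →L[ℝ] E³),
      IsSuitableWeakSolutionOn (slab E³ (Iio 0) isOpen_Iio) 1 0 N q ∧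
      HasWeakSpatialGradientOn (slab E³ (Iio 0) isOpen_Iio) N H ∧
      typeIBound (Iio (0 : ℝ) ×ˢ univ) N q H < ⊤ ∧
      ¬ (uncurry N =ᵐ[volume.restrict (Iio (0 : ℝ) ×ˢ (univ : Set E³))] 0) ∧
      ∀ t : ℝ, t < 0 → ∀ x : E³, ‖N t x‖ ≤ C' / (1 + ‖x‖ + Real.sqrt (-t))) →
    ∃ (C' : ℝ) (u : ℝ → E³ → E³) (p : ℝ → E³ → ℝ) (G : ℝ → E³ → E³ →L[ℝ] E³),
      IsSuitableWeakSolutionOn (slab E³ (Iio 0) isOpen_Iio) 1 0 u p ∧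
      HasWeakSpatialGradientOn (slab E³ (Iio 0) isOpen_Iio) u G ∧
      typeIBound (Iio (0 : ℝ) ×ˢ univ) u p G < ⊤ ∧ HasTypeIDecay C' u ∧
      IsBackwardSingularPoint u 0 := by
  intro hEngine
  rintro ⟨C', N, q, H, hsw, hwg, hI, hnt, hdec⟩
  -- ## Step 0: `0 ≤ C'` (some value of `N` has nonnegative norm)
  have hC' : 0 ≤ C' := by
    by_contra hlt
    have hlt' : C' < 0 := lt_of_not_ge hlt
    have h := hdec (-1) (by norm_num) 0
    have hneg : C' / (1 + ‖(0 : E³)‖ + Real.sqrt (-(-1 : ℝ))) < 0 :=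
      div_neg_of_neg_of_pos hlt' (by positivity)
    linarith [norm_nonneg (N (-1) 0)]
  set I : ℝ≥0∞ := typeIBound (Iio (0 : ℝ) ×ˢ (univ : Set E³)) N q H with hIdef
  -- ## Step 1: non-triviality gives a ball `Q(0, ρ)` with `‖N‖_{L^∞(Q(0, ρ))} ≠ 0`
  have hNm : AEStronglyMeasurable (uncurry N) (volume.restrict (Iio (0 : ℝ) ×ˢ (univ : Set E³))) :=
    hwg.locallyIntegrableOn.aestronglyMeasurable
  obtain ⟨n₀, hN⟩ := exists_radius_eLpNorm_top_ne_zero hNm hnt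
  have hρpos : 0 < (n₀ : ℝ) + 1 := by positivity
  -- ## Step 2: the blow-down sequence about the origin
  set c : ℕ → ℝ := fun k => (k : ℝ) + 1 with hc
  have hcpos : ∀ k, 0 < c k := fun k => by positivity
  have hctop : Tendsto c atTop atTop :=
    tendsto_atTop_add_const_right _ _ tendsto_natCast_atTop_atTop
  set v : ℕ → ℝ → E³ → E³ := fun k => c k • stPull (c k ^ 2) (c k) 0 (0 : E³) N with hv
  set qk : ℕ → ℝ → E³ → ℝ := fun k => c k ^ 2 • stPull (c k ^ 2) (c k) 0 (0 : E³) q with hqk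
  set Gk : ℕ → ℝ → E³ → E³ →L[ℝ] E³ :=
    fun k => c k ^ 2 • stPull (c k ^ 2) (c k) 0 (0 : E³) H with hGk
  have hswk : ∀ k, IsSuitableWeakSolutionOn (slab E³ (Iio 0) isOpen_Iio) 1 0 (v k) (qk k) := by
    intro k
    have h := zoom_isSuitableWeakSolutionOn hsw (hcpos k) 0 (0 : E³)
    rwa [stPreimage_slab_origin (hcpos k)] at h
  have hwgk : ∀ k, HasWeakSpatialGradientOn (slab E³ (Iio 0) isOpen_Iio) (v k) (Gk k) := by
    intro k
    have h := zoom_hasWeakSpatialGradientOn hwg (hcpos k) 0 (0 : E³)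
    rwa [stPreimage_slab_origin (hcpos k)] at h
  have hbdk : ∀ k, typeIBound (Iio (0 : ℝ) ×ˢ univ) (v k) (qk k) (Gk k) ≤ I := fun k =>
    (typeIBound_lowerHalf_nsZoom (hcpos k) N q H).le
  -- the apex bound holds for every `v_k`, pointwise below time `0`
  have hapexk : ∀ k (w : ℝ × E³), w.1 < 0 → ‖v k w.1 w.2‖ ≤ C' / (‖w.2‖ + Real.sqrt (-w.1)) :=
    fun k w hw => norm_nsZoom_origin_le_apex hC' hdec (hcpos k) hw w.2
  -- ## Step 3: the ENGINE
  obtain ⟨u, p, H', σ, hσ, hswu, hH', h4I, hconv, hpers⟩ := hEngine I v qk Gk hI hswk hwgk hbdk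
  -- ## Step 4: the origin is a backward singular point (persistence of singularities)
  have hsing : IsBackwardSingularPoint u 0 := hpers fun R hR =>
    (tendsto_eLpNorm_top_nsZoom_origin_atTop (u := N) (fun j => hcpos (σ j))
      (hctop.comp hσ.tendsto_atTop) hρpos hN hR).limsup_eq
  -- ## Step 5: the apex bound passes to the a.e. limit
  have hapex : ∀ᵐ w ∂(volume.restrict (Iio (0 : ℝ) ×ˢ (univ : Set E³))),
      ‖u w.1 w.2‖ ≤ C' / (‖w.2‖ + Real.sqrt (-w.1)) := by
    refine ae_restrict_of_ae_restrict_of_subset lowerHalf_subset_iUnion_parabolicCylinder ?_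
    rw [ae_restrict_iUnion_iff]
    intro n
    set Q₀ : Set (ℝ × E³) := parabolicCylinder ((n : ℝ) + 1) (0 : ℝ × E³) with hQ₀
    have hQ₀s : Q₀ ⊆ Iio (0 : ℝ) ×ˢ (univ : Set E³) := parabolicCylinder_subset_lowerHalf le_rfl _
    have hvm : ∀ j, AEStronglyMeasurable (uncurry (v (σ j))) (volume.restrict Q₀) := fun j =>
      (hwgk (σ j)).locallyIntegrableOn.aestronglyMeasurable.mono_measure
        (Measure.restrict_mono hQ₀s le_rfl)
    have hum : AEStronglyMeasurable (uncurry u) (volume.restrict Q₀) :=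
      hH'.locallyIntegrableOn.aestronglyMeasurable.mono_measure (Measure.restrict_mono hQ₀s le_rfl)
    have hTIM : TendstoInMeasure (volume.restrict Q₀) (fun j => uncurry (v (σ j))) atTop
        (uncurry u) :=
      tendstoInMeasure_of_tendsto_eLpNorm (by norm_num) hvm hum (hconv _ (by positivity))
    obtain ⟨ns, -, hae⟩ := hTIM.exists_seq_tendsto_ae
    filter_upwards [hae, ae_restrict_mem (isOpen_parabolicCylinder _ _).measurableSet]
      with w hw hwQ
    have hw0 : w.1 < 0 := (hQ₀s hwQ).1
    exact le_of_tendsto' hw.norm fun i => hapexk (σ (ns i)) w hw0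
  -- ## Step 6: `𝐈 < ∞` and the representative with the pointwise apex bound
  have hIu : typeIBound (Iio (0 : ℝ) ×ˢ univ) u p H' < ⊤ :=
    lt_of_le_of_lt h4I (ENNReal.mul_lt_top (by simp) hI)
  obtain ⟨u', -, h1, h2, h3, h4, h5⟩ := exists_apex_profile_repr hC' hswu hH' hIu hsing hapex
  exact ⟨C', u', p, H', h1, h2, h3, h4, h5⟩

end Summit.NavierStokesRegularity.NavierStokesRegularity.Theorems.RellichScarApexLocalisation
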